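import Summits.AtomisticToContinuum.Crystallization.Theorems.FrustratedLawDichotomyAperiodicGapRecordJunctionTail
import Summits.AtomisticToContinuum.Crystallization.Theorems.FrustratedLawDichotomyStrainedPatchRimFold
import Summits.AtomisticToContinuum.Crystallization.Theorems.FrustratedLawDichotomyStrainedPatchHomEntryLeafHTUCentredRot
import HarnessLib

/-!
# FrustratedLawDichotomy · crux `AperiodicFrustratedLawGap` (stmt-AtomisticToContinuum-27623) — RECORD JUNCTION, RIM-FOLDED FORM (R1‴ of record)
# (decomp-a2c, lens-5 generation 74 for prover hand 2; structural share, sequel of `…AperiodicGapRecordJunctionTail`)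

Critic row 1230 found R1″ (`…TailPacking.coreOff_of_envelope_tailCert`) SOUND but UNINSTANTIABLE AS TYPED (rim rows priced ≥ 20.3 σ₁ by (HSTEP) ⇒ no
terminal certificate); lens-5 g74 JOB 1 (`…StrainedPatchRimFold`, critic row 1239: «R1‴ := coreOff_of_envelope_tailCert_fold is the E-side R1 OF RECORD»)
folds the rim: box tops and step bounds only at host rows within `R` of the centre, rows beyond `R` carried by the loosened column `foldCol R X Q`
(`Q` = any certified finite rim box top, `HostRimTop`), the terminal `SlackCert` on the folded column.  This DEF-FREE module threads R1‴ to the crux,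
exactly as `…RecordJunctionTail` threads R1″, and against the hcp E-consumer OF RECORD `homFloor_625_of_entryTrees6RBKP_HT4UQDCRX` (critic row 1238):
* §1 `strainedPatchRec_of_homFloor_625_of_envelope_tailCert_fold` / `…_of_gammaTable_tailCert_fold`;
* §2 the crux BY NAME `aperiodicFrustratedLawGap_of_entryTreesU_of_envelope_tailCert_fold` (+ periodic sibling 27624) and the γ-table form;
* §3 sanity at the cell width of record `τ = 1/100` (side conditions `1/50 < s₀`, `r ≤ 349/50`).

T-SIDE BINDER CENSUS after this file (every binder family-level, per-host or per-host-row; none cluster-quantified): FamilyCover 𝓘 (24/5) (1/100) (1/8) τ ·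
HostSep 𝓘 s₀ · HostFarTab 𝓘 τ r Xh · TailCert 𝓘 τ Xe · column domination Xh + Xe ≤ X · HostRimTop (rim box tops Q beyond R) · HostTopIn (box top within R) ·
HostStepIn-table (steps within R on the folded column) · SlackCert on `foldCol R X Q` · `∀ i, 0 ≤ k i` (+ the numeric side conditions 0 ≤ τ, 2τ < s₀, r + 2τ ≤ 7).
One-line compositions of tree theorems; 0 sorry; no definitions; standard axioms.  `--supports stmt-AtomisticToContinuum-27623`.
[folklore instantiation]
-/

noncomputable section

namespace Summit.AtomisticToContinuum.Crystallization.Theorems.FrustratedLawDichotomyAperiodicGapRecordJunctionFold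

open Summit.AtomisticToContinuum.Crystallization.Theorems.ChargedEnergyGapNegative (eStar E3)
open Summit.AtomisticToContinuum.Crystallization.Theorems.FrustratedLawDichotomyRangeCut
open Summit.AtomisticToContinuum.Crystallization.Theorems.FrustratedLawDichotomySchurCut
open Summit.AtomisticToContinuum.Crystallization.Theorems.FrustratedLawDichotomyMotifLemmas (GoodAtScale)
open Summit.AtomisticToContinuum.Crystallization.Theorems.FrustratedLawDichotomyExemptLocOpt (LocOptFails)
open Summit.AtomisticToContinuum.Crystallization.Theorems.FrustratedLawDichotomyExemptSplit (SchurElasticPricingX)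
open Summit.AtomisticToContinuum.Crystallization.Theorems.FrustratedLawDichotomyExemptAbsorptionRecord
open Summit.AtomisticToContinuum.Crystallization.Theorems.FrustratedLawDichotomyCollarCensus
open Summit.AtomisticToContinuum.Crystallization.Theorems.FrustratedLawDichotomyCollarCensusKappa
open Summit.AtomisticToContinuum.Crystallization.Theorems.FrustratedLawDichotomyStrainedPatchHomSplit
open Summit.AtomisticToContinuum.Crystallization.Theorems.FrustratedLawDichotomyStrainedPatchCleanCollar (TailPenalty AnnularDefectFloor DefectiveCollarFloor)
open Summit.AtomisticToContinuum.Crystallization.Theorems.FrustratedLawDichotomyStrainedPatchPhaseCut (AnnularPhaseFloor PolyTextureFloor)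
open Summit.AtomisticToContinuum.Crystallization.Theorems.FrustratedLawDichotomyStrainedPatchCoreTube (CoreOffTubeFloor)
open Summit.AtomisticToContinuum.Crystallization.Theorems.FrustratedLawDichotomyStrainedPatchCoreTubeRecord (CoreCoreRelief seam_arith_core
  strainedPatchRec_of_homFloor_of_tailPenalty_of_coreRelief_of_coreOff_of_annularPhase_of_poly_of_annular_of_near)
open Summit.AtomisticToContinuum.Crystallization.Theorems.FrustratedLawDichotomyStrainedPatchHostCells (FamP FamilyCover)
open Summit.AtomisticToContinuum.Crystallization.Theorems.FrustratedLawDichotomyStrainedPatchHomCertTree (CertTree treeOK)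
open Summit.AtomisticToContinuum.Crystallization.Theorems.FrustratedLawDichotomyStrainedPatchHomEntryGram (rootC rootW)
open Summit.AtomisticToContinuum.Crystallization.Theorems.FrustratedLawDichotomyStrainedPatchHomEntryGramHcp (rootCH rootWH)
open Summit.AtomisticToContinuum.Crystallization.Theorems.FrustratedLawDichotomyStrainedPatchHomEntryTable (muRec)
open Summit.AtomisticToContinuum.Crystallization.Theorems.FrustratedLawDichotomyStrainedPatchHomEntryTableP (entryLeafOK6RBKP)
open Summit.AtomisticToContinuum.Crystallization.Theorems.FrustratedLawDichotomyStrainedPatchHomEntryLeafHT (HTCert entryLeafOKHT4UQDCRX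
  homFloor_625_of_entryTrees6RBKP_HT4UQDCRX)
open Summit.AtomisticToContinuum.Crystallization.Theorems.FrustratedLawDichotomyStrainedPatchQuantSlaving (ChartFam HessTab ForceTab SlackTab hessBlk0 force0)
open Summit.AtomisticToContinuum.Crystallization.Theorems.FrustratedLawDichotomyStrainedPatchSVCharge (SlackCert)
open Summit.AtomisticToContinuum.Crystallization.Theorems.FrustratedLawDichotomyStrainedPatchTaylorCharge (HostSep cubicTail)
open Summit.AtomisticToContinuum.Crystallization.Theorems.FrustratedLawDichotomyStrainedPatchBondCalculus (bondD3 bondGamma)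
open Summit.AtomisticToContinuum.Crystallization.Theorems.FrustratedLawDichotomyStrainedPatchFarSplit (HostFarTab gammaMaj)
open Summit.AtomisticToContinuum.Crystallization.Theorems.FrustratedLawDichotomyStrainedPatchTailPacking (TailCert)
open Summit.AtomisticToContinuum.Crystallization.Theorems.FrustratedLawDichotomyAperiodicGapRecordJunction
open Summit.AtomisticToContinuum.Crystallization.Theorems.FrustratedLawDichotomyStrainedPatchRimFold (HostTopIn HostRimTop HostStepIn foldCol
  coreOff_of_envelope_tailCert_fold coreOff_of_gammaTable_tailCert_fold)

/-! ## §1 `StrainedPatchRec` from R1‴ -/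

/-- ★★★ **R1‴ ⟹ StrainedPatchRec (envelope form, rim-folded)**: `HomFloor (1/625) ∧ TailPenalty (24/5) (1/1000) ∧ CoreCoreRelief … (3/5000) ∧
FamilyCover 𝓘 (24/5) (1/100) (1/8) τ ∧ 2τ < s₀ ∧ HostSep 𝓘 s₀ ∧ r + 2τ ≤ 7 ∧ HostFarTab 𝓘 τ r Xh ∧ TailCert 𝓘 τ Xe ∧ (Xh + Xe ≤ X) ∧ (∀ i, 0 ≤ k i) ∧
HostRimTop/HostTopIn/HostStepIn-table at radius R with the closed-form tail `cubicTail (s ↦ gammaMaj (s − 2τ))` on the folded column `foldCol R X Q` ∧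
SlackCert … (k n) … (foldCol R X Q) ∧ AnnularPhaseFloor ∧ PolyTextureFloor ∧ AnnularDefectFloor ∧ DefectiveCollarFloor ⟹ StrainedPatchRec`.
[folklore instantiation: `…CoreTubeRecord.strainedPatchRec_of_homFloor_of_…` with `hC := …RimFold.coreOff_of_envelope_tailCert_fold`] -/
theorem strainedPatchRec_of_homFloor_625_of_envelope_tailCert_fold {𝓘 : ChartFam} {τ s₀ r R : ℝ} {X Xh Xe Q : SlackTab} (k : ℕ → ℝ) (n : ℕ)
    (hτ : 0 ≤ τ) (hk : ∀ i : ℕ, 0 ≤ k i)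
    (hHF : HomFloor (1 / 625)) (hT : TailPenalty (24 / 5) (1 / 1000)) (hRl : CoreCoreRelief (63 / 10) (63 / 10) (24 / 5) (1 / 100) (3 / 5000))
    (hFC : FamilyCover 𝓘 (24 / 5) (1 / 100) (1 / 8) τ) (hτs : 2 * τ < s₀) (hsep : HostSep 𝓘 s₀) (hr7 : r + 2 * τ ≤ 7)
    (hH : HostFarTab 𝓘 τ r Xh) (hTC : TailCert 𝓘 τ Xe)
    (hdom : ∀ (M₀ : ℕ) (z₀ : Fin M₀ → E3) (c₀ h : Fin M₀), Xh M₀ z₀ c₀ h + Xe M₀ z₀ c₀ h ≤ X M₀ z₀ c₀ h)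
    (hQ : HostRimTop 𝓘 τ bondD3 (cubicTail fun s => gammaMaj (s - 2 * τ)) r R Q)
    (h0 : HostTopIn 𝓘 τ bondD3 (cubicTail fun s => gammaMaj (s - 2 * τ)) r R (k 0 * sigmaOne))
    (hs : ∀ i : ℕ, i < n →
      HostStepIn 𝓘 τ sigmaOne bondD3 (cubicTail fun s => gammaMaj (s - 2 * τ)) r hessBlk0 force0 (foldCol R X Q) (k i) R (k (i + 1) * sigmaOne))
    (hC : SlackCert 𝓘 τ (k n) sigmaOne hessBlk0 force0 (foldCol R X Q))
    (hF : AnnularPhaseFloor (63 / 10) (24 / 5) (63 / 10) (1 / 1000)) (hP : PolyTextureFloor (63 / 10) (24 / 5) (1 / 1000))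
    (hA : AnnularDefectFloor (24 / 5) (63 / 10)) (hD : DefectiveCollarFloor (24 / 5)) : StrainedPatchRec :=
  strainedPatchRec_of_homFloor_of_tailPenalty_of_coreRelief_of_coreOff_of_annularPhase_of_poly_of_annular_of_near (by norm_num) hHF hT hRl
    seam_arith_core (coreOff_of_envelope_tailCert_fold k n hτ hk hFC hτs hsep hr7 hH hTC hdom hQ h0 hs hC) hF hP le_rfl (by norm_num) (by norm_num)
    hA hD

/-- ★★★ **R1‴ ⟹ StrainedPatchRec (census γ-table form, rim-folded)**: the same with a γ-table `bondGamma ≤ L` on the `2τ`-bands and the tail `cubicTail L`.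
[folklore instantiation: `hC := …RimFold.coreOff_of_gammaTable_tailCert_fold`] -/
theorem strainedPatchRec_of_homFloor_625_of_gammaTable_tailCert_fold {𝓘 : ChartFam} {τ s₀ r R : ℝ} {L : ℝ → ℝ} {X Xh Xe Q : SlackTab} (k : ℕ → ℝ)
    (n : ℕ) (hτ : 0 ≤ τ) (hk : ∀ i : ℕ, 0 ≤ k i)
    (hHF : HomFloor (1 / 625)) (hT : TailPenalty (24 / 5) (1 / 1000)) (hRl : CoreCoreRelief (63 / 10) (63 / 10) (24 / 5) (1 / 100) (3 / 5000))
    (hFC : FamilyCover 𝓘 (24 / 5) (1 / 100) (1 / 8) τ) (hτs : 2 * τ < s₀)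
    (hL : ∀ s : ℝ, s₀ ≤ s → s < r → ∀ s' : ℝ, |s' - s| ≤ 2 * τ → bondGamma s' ≤ L s) (hsep : HostSep 𝓘 s₀) (hr7 : r + 2 * τ ≤ 7)
    (hH : HostFarTab 𝓘 τ r Xh) (hTC : TailCert 𝓘 τ Xe)
    (hdom : ∀ (M₀ : ℕ) (z₀ : Fin M₀ → E3) (c₀ h : Fin M₀), Xh M₀ z₀ c₀ h + Xe M₀ z₀ c₀ h ≤ X M₀ z₀ c₀ h)
    (hQ : HostRimTop 𝓘 τ bondD3 (cubicTail L) r R Q) (h0 : HostTopIn 𝓘 τ bondD3 (cubicTail L) r R (k 0 * sigmaOne))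
    (hs : ∀ i : ℕ, i < n → HostStepIn 𝓘 τ sigmaOne bondD3 (cubicTail L) r hessBlk0 force0 (foldCol R X Q) (k i) R (k (i + 1) * sigmaOne))
    (hC : SlackCert 𝓘 τ (k n) sigmaOne hessBlk0 force0 (foldCol R X Q))
    (hF : AnnularPhaseFloor (63 / 10) (24 / 5) (63 / 10) (1 / 1000)) (hP : PolyTextureFloor (63 / 10) (24 / 5) (1 / 1000))
    (hA : AnnularDefectFloor (24 / 5) (63 / 10)) (hD : DefectiveCollarFloor (24 / 5)) : StrainedPatchRec :=
  strainedPatchRec_of_homFloor_of_tailPenalty_of_coreRelief_of_coreOff_of_annularPhase_of_poly_of_annular_of_near (by norm_num) hHF hT hRl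
    seam_arith_core (coreOff_of_gammaTable_tailCert_fold k n hτ hk hFC hτs hL hsep hr7 hH hTC hdom hQ h0 hs hC) hF hP le_rfl (by norm_num)
    (by norm_num) hA hD

/-! ## §2 The crux BY NAME from the entry trees (hcp: the HTU consumer of record) and R1‴ -/

/-- ★★★ **27623 FROM THE ENTRY TREES AND R1‴ (envelope form, rim-folded)** — the record junction with NO cluster-quantified T-side binder and the hcp
E-consumer of record `entryLeafOKHT4UQDCRX` (critic row 1238): the crux BY NAME from
`UP ∧ 0 ≤ D_X ∧ Eopt-raw ∧ (∃ fcc tree) ∧ (∃ hcp HT4UQDCRX tree) ∧ TailPenalty ∧ CoreCoreRelief ∧ FamilyCover ∧ 2τ < s₀ ∧ HostSep ∧ r + 2τ ≤ 7 ∧ HostFarTab ∧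
TailCert ∧ (Xh + Xe ≤ X) ∧ (∀ i, 0 ≤ k i) ∧ HostRimTop ∧ HostTopIn ∧ HostStepIn-table ∧ SlackCert (folded column) ∧ AnnularPhaseFloor ∧ PolyTextureFloor ∧
AnnularDefectFloor ∧ DefectiveCollarFloor ∧ CC∪T₀ ∧ DD∪T₀`. [folklore instantiation] -/
theorem aperiodicFrustratedLawGap_of_entryTreesU_of_envelope_tailCert_fold {𝓘 : ChartFam} {τ s₀ r R : ℝ} {X Xh Xe Q : SlackTab}
    {εE CE DE DX : ℝ} (k : ℕ → ℝ) (n : ℕ) (hτ : 0 ≤ τ) (hk : ∀ i : ℕ, 0 ≤ k i)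
    (hε0 : 0 < εE) (hε1 : εE ≤ 1 / 10000) (hU : PeriodicEnergyCeiling (-(7175 / 10000))) (hDX : 0 ≤ DX)
    (hE : SchurElasticPricingX (1 / 20) (1 / 8) w₄₅ ω₄ (3 / 400) (-(7175 / 10000)) (1 / 10000) CE DE DX (LocOptFails eStar εE (3 / 2) 1))
    (P : ((Fin 3 × Fin 3) ⊕ Fin 3 → ℤ) → ((Fin 3 × Fin 3) ⊕ Fin 3 → ℤ) → HTCert)
    (Qf : ((Fin 3 × Fin 3) ⊕ Fin 3 → ℤ) → ((Fin 3 × Fin 3) ⊕ Fin 3 → ℤ) → (Fin 4 → ℤ))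
    (T : ((Fin 3 × Fin 3) ⊕ Fin 3 → ℤ) → ((Fin 3 × Fin 3) ⊕ Fin 3 → ℤ) → CertTree ((Fin 3 × Fin 3) ⊕ Fin 3))
    (hFcc : ∃ t : CertTree (Fin 3 × Fin 3), treeOK (entryLeafOK6RBKP muRec) t rootC rootW = true)
    (hHcp : ∃ t : CertTree ((Fin 3 × Fin 3) ⊕ Fin 3), treeOK (entryLeafOKHT4UQDCRX muRec P Qf T) t rootCH rootWH = true)
    (hT : TailPenalty (24 / 5) (1 / 1000)) (hRl : CoreCoreRelief (63 / 10) (63 / 10) (24 / 5) (1 / 100) (3 / 5000))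
    (hFC : FamilyCover 𝓘 (24 / 5) (1 / 100) (1 / 8) τ) (hτs : 2 * τ < s₀) (hsep : HostSep 𝓘 s₀) (hr7 : r + 2 * τ ≤ 7)
    (hH : HostFarTab 𝓘 τ r Xh) (hTC : TailCert 𝓘 τ Xe)
    (hdom : ∀ (M₀ : ℕ) (z₀ : Fin M₀ → E3) (c₀ h : Fin M₀), Xh M₀ z₀ c₀ h + Xe M₀ z₀ c₀ h ≤ X M₀ z₀ c₀ h)
    (hQ : HostRimTop 𝓘 τ bondD3 (cubicTail fun s => gammaMaj (s - 2 * τ)) r R Q)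
    (h0 : HostTopIn 𝓘 τ bondD3 (cubicTail fun s => gammaMaj (s - 2 * τ)) r R (k 0 * sigmaOne))
    (hs : ∀ i : ℕ, i < n →
      HostStepIn 𝓘 τ sigmaOne bondD3 (cubicTail fun s => gammaMaj (s - 2 * τ)) r hessBlk0 force0 (foldCol R X Q) (k i) R (k (i + 1) * sigmaOne))
    (hC : SlackCert 𝓘 τ (k n) sigmaOne hessBlk0 force0 (foldCol R X Q))
    (hF : AnnularPhaseFloor (63 / 10) (24 / 5) (63 / 10) (1 / 1000)) (hP : PolyTextureFloor (63 / 10) (24 / 5) (1 / 1000))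
    (hA : AnnularDefectFloor (24 / 5) (63 / 10)) (hD : DefectiveCollarFloor (24 / 5))
    (h2 : CrowdedCoreMotifPricingCapK (1 / 1000) (9 / 5) (133 / 10) (3 / 2) (effPot w₄₅ ω₄ (3 / 400)) (-(7175 / 10000) + 3 / 400)
      (Collar (9 / 2) fun N y j => (∃ s : ℝ, 0 ≤ s ∧ s ≤ 3 / 2 ∧ NonEquilibriumCore (-(7175 / 10000)) 0 7 s (1 / 10000) N y j) ∨
        GoodAtScale (1 / 20) (3 / 2) y j))
    (h3 : DiluteDefectMotifPricingCapK (1 / 1000) (9 / 5) (133 / 10) (3 / 2) (effPot w₄₅ ω₄ (3 / 400)) (-(7175 / 10000) + 3 / 400)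
      (Collar (9 / 2) fun N y j => (∃ s : ℝ, 0 ≤ s ∧ s ≤ 3 / 2 ∧ NonEquilibriumCore (-(7175 / 10000)) 0 7 s (1 / 10000) N y j) ∨
        GoodAtScale (1 / 20) (3 / 2) y j)) :
    Summit.AtomisticToContinuum.Crystallization.Theses.FrustratedLawDichotomy.AperiodicFrustratedLawGap :=
  aperiodicFrustratedLawGap_of_strainedPatchRec hε0 hε1 hU hDX hE
    (strainedPatchRec_of_homFloor_625_of_envelope_tailCert_fold k n hτ hk (homFloor_625_of_entryTrees6RBKP_HT4UQDCRX P Qf T hFcc hHcp) hT hRl hFC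
      hτs hsep hr7 hH hTC hdom hQ h0 hs hC hF hP hA hD) h2 h3

/-- ★★ **Periodic sibling (27624)** of `aperiodicFrustratedLawGap_of_entryTreesU_of_envelope_tailCert_fold`. [folklore instantiation] -/
theorem periodicFrustratedLawGap_of_entryTreesU_of_envelope_tailCert_fold {𝓘 : ChartFam} {τ s₀ r R : ℝ} {X Xh Xe Q : SlackTab}
    {εE CE DE DX : ℝ} (k : ℕ → ℝ) (n : ℕ) (hτ : 0 ≤ τ) (hk : ∀ i : ℕ, 0 ≤ k i)
    (hε0 : 0 < εE) (hε1 : εE ≤ 1 / 10000) (hU : PeriodicEnergyCeiling (-(7175 / 10000))) (hDX : 0 ≤ DX)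
    (hE : SchurElasticPricingX (1 / 20) (1 / 8) w₄₅ ω₄ (3 / 400) (-(7175 / 10000)) (1 / 10000) CE DE DX (LocOptFails eStar εE (3 / 2) 1))
    (P : ((Fin 3 × Fin 3) ⊕ Fin 3 → ℤ) → ((Fin 3 × Fin 3) ⊕ Fin 3 → ℤ) → HTCert)
    (Qf : ((Fin 3 × Fin 3) ⊕ Fin 3 → ℤ) → ((Fin 3 × Fin 3) ⊕ Fin 3 → ℤ) → (Fin 4 → ℤ))
    (T : ((Fin 3 × Fin 3) ⊕ Fin 3 → ℤ) → ((Fin 3 × Fin 3) ⊕ Fin 3 → ℤ) → CertTree ((Fin 3 × Fin 3) ⊕ Fin 3))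
    (hFcc : ∃ t : CertTree (Fin 3 × Fin 3), treeOK (entryLeafOK6RBKP muRec) t rootC rootW = true)
    (hHcp : ∃ t : CertTree ((Fin 3 × Fin 3) ⊕ Fin 3), treeOK (entryLeafOKHT4UQDCRX muRec P Qf T) t rootCH rootWH = true)
    (hT : TailPenalty (24 / 5) (1 / 1000)) (hRl : CoreCoreRelief (63 / 10) (63 / 10) (24 / 5) (1 / 100) (3 / 5000))
    (hFC : FamilyCover 𝓘 (24 / 5) (1 / 100) (1 / 8) τ) (hτs : 2 * τ < s₀) (hsep : HostSep 𝓘 s₀) (hr7 : r + 2 * τ ≤ 7)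
    (hH : HostFarTab 𝓘 τ r Xh) (hTC : TailCert 𝓘 τ Xe)
    (hdom : ∀ (M₀ : ℕ) (z₀ : Fin M₀ → E3) (c₀ h : Fin M₀), Xh M₀ z₀ c₀ h + Xe M₀ z₀ c₀ h ≤ X M₀ z₀ c₀ h)
    (hQ : HostRimTop 𝓘 τ bondD3 (cubicTail fun s => gammaMaj (s - 2 * τ)) r R Q)
    (h0 : HostTopIn 𝓘 τ bondD3 (cubicTail fun s => gammaMaj (s - 2 * τ)) r R (k 0 * sigmaOne))
    (hs : ∀ i : ℕ, i < n →
      HostStepIn 𝓘 τ sigmaOne bondD3 (cubicTail fun s => gammaMaj (s - 2 * τ)) r hessBlk0 force0 (foldCol R X Q) (k i) R (k (i + 1) * sigmaOne))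
    (hC : SlackCert 𝓘 τ (k n) sigmaOne hessBlk0 force0 (foldCol R X Q))
    (hF : AnnularPhaseFloor (63 / 10) (24 / 5) (63 / 10) (1 / 1000)) (hP : PolyTextureFloor (63 / 10) (24 / 5) (1 / 1000))
    (hA : AnnularDefectFloor (24 / 5) (63 / 10)) (hD : DefectiveCollarFloor (24 / 5))
    (h2 : CrowdedCoreMotifPricingCapK (1 / 1000) (9 / 5) (133 / 10) (3 / 2) (effPot w₄₅ ω₄ (3 / 400)) (-(7175 / 10000) + 3 / 400)
      (Collar (9 / 2) fun N y j => (∃ s : ℝ, 0 ≤ s ∧ s ≤ 3 / 2 ∧ NonEquilibriumCore (-(7175 / 10000)) 0 7 s (1 / 10000) N y j) ∨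
        GoodAtScale (1 / 20) (3 / 2) y j))
    (h3 : DiluteDefectMotifPricingCapK (1 / 1000) (9 / 5) (133 / 10) (3 / 2) (effPot w₄₅ ω₄ (3 / 400)) (-(7175 / 10000) + 3 / 400)
      (Collar (9 / 2) fun N y j => (∃ s : ℝ, 0 ≤ s ∧ s ≤ 3 / 2 ∧ NonEquilibriumCore (-(7175 / 10000)) 0 7 s (1 / 10000) N y j) ∨
        GoodAtScale (1 / 20) (3 / 2) y j)) :
    Summit.AtomisticToContinuum.Crystallization.Theses.FrustratedLawDichotomy.PeriodicFrustratedLawGap :=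
  periodicFrustratedLawGap_of_strainedPatchRec hε0 hε1 hU hDX hE
    (strainedPatchRec_of_homFloor_625_of_envelope_tailCert_fold k n hτ hk (homFloor_625_of_entryTrees6RBKP_HT4UQDCRX P Qf T hFcc hHcp) hT hRl hFC
      hτs hsep hr7 hH hTC hdom hQ h0 hs hC hF hP hA hD) h2 h3

/-- ★★★ **27623 FROM THE ENTRY TREES AND R1‴ (census γ-table form, rim-folded)**. [folklore instantiation] -/
theorem aperiodicFrustratedLawGap_of_entryTreesU_of_gammaTable_tailCert_fold {𝓘 : ChartFam} {τ s₀ r R : ℝ} {L : ℝ → ℝ} {X Xh Xe Q : SlackTab}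
    {εE CE DE DX : ℝ} (k : ℕ → ℝ) (n : ℕ) (hτ : 0 ≤ τ) (hk : ∀ i : ℕ, 0 ≤ k i)
    (hε0 : 0 < εE) (hε1 : εE ≤ 1 / 10000) (hU : PeriodicEnergyCeiling (-(7175 / 10000))) (hDX : 0 ≤ DX)
    (hE : SchurElasticPricingX (1 / 20) (1 / 8) w₄₅ ω₄ (3 / 400) (-(7175 / 10000)) (1 / 10000) CE DE DX (LocOptFails eStar εE (3 / 2) 1))
    (P : ((Fin 3 × Fin 3) ⊕ Fin 3 → ℤ) → ((Fin 3 × Fin 3) ⊕ Fin 3 → ℤ) → HTCert)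
    (Qf : ((Fin 3 × Fin 3) ⊕ Fin 3 → ℤ) → ((Fin 3 × Fin 3) ⊕ Fin 3 → ℤ) → (Fin 4 → ℤ))
    (T : ((Fin 3 × Fin 3) ⊕ Fin 3 → ℤ) → ((Fin 3 × Fin 3) ⊕ Fin 3 → ℤ) → CertTree ((Fin 3 × Fin 3) ⊕ Fin 3))
    (hFcc : ∃ t : CertTree (Fin 3 × Fin 3), treeOK (entryLeafOK6RBKP muRec) t rootC rootW = true)
    (hHcp : ∃ t : CertTree ((Fin 3 × Fin 3) ⊕ Fin 3), treeOK (entryLeafOKHT4UQDCRX muRec P Qf T) t rootCH rootWH = true)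
    (hT : TailPenalty (24 / 5) (1 / 1000)) (hRl : CoreCoreRelief (63 / 10) (63 / 10) (24 / 5) (1 / 100) (3 / 5000))
    (hFC : FamilyCover 𝓘 (24 / 5) (1 / 100) (1 / 8) τ) (hτs : 2 * τ < s₀)
    (hL : ∀ s : ℝ, s₀ ≤ s → s < r → ∀ s' : ℝ, |s' - s| ≤ 2 * τ → bondGamma s' ≤ L s) (hsep : HostSep 𝓘 s₀) (hr7 : r + 2 * τ ≤ 7)
    (hH : HostFarTab 𝓘 τ r Xh) (hTC : TailCert 𝓘 τ Xe)
    (hdom : ∀ (M₀ : ℕ) (z₀ : Fin M₀ → E3) (c₀ h : Fin M₀), Xh M₀ z₀ c₀ h + Xe M₀ z₀ c₀ h ≤ X M₀ z₀ c₀ h)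
    (hQ : HostRimTop 𝓘 τ bondD3 (cubicTail L) r R Q) (h0 : HostTopIn 𝓘 τ bondD3 (cubicTail L) r R (k 0 * sigmaOne))
    (hs : ∀ i : ℕ, i < n → HostStepIn 𝓘 τ sigmaOne bondD3 (cubicTail L) r hessBlk0 force0 (foldCol R X Q) (k i) R (k (i + 1) * sigmaOne))
    (hC : SlackCert 𝓘 τ (k n) sigmaOne hessBlk0 force0 (foldCol R X Q))
    (hF : AnnularPhaseFloor (63 / 10) (24 / 5) (63 / 10) (1 / 1000)) (hP : PolyTextureFloor (63 / 10) (24 / 5) (1 / 1000))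
    (hA : AnnularDefectFloor (24 / 5) (63 / 10)) (hD : DefectiveCollarFloor (24 / 5))
    (h2 : CrowdedCoreMotifPricingCapK (1 / 1000) (9 / 5) (133 / 10) (3 / 2) (effPot w₄₅ ω₄ (3 / 400)) (-(7175 / 10000) + 3 / 400)
      (Collar (9 / 2) fun N y j => (∃ s : ℝ, 0 ≤ s ∧ s ≤ 3 / 2 ∧ NonEquilibriumCore (-(7175 / 10000)) 0 7 s (1 / 10000) N y j) ∨
        GoodAtScale (1 / 20) (3 / 2) y j))
    (h3 : DiluteDefectMotifPricingCapK (1 / 1000) (9 / 5) (133 / 10) (3 / 2) (effPot w₄₅ ω₄ (3 / 400)) (-(7175 / 10000) + 3 / 400)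
      (Collar (9 / 2) fun N y j => (∃ s : ℝ, 0 ≤ s ∧ s ≤ 3 / 2 ∧ NonEquilibriumCore (-(7175 / 10000)) 0 7 s (1 / 10000) N y j) ∨
        GoodAtScale (1 / 20) (3 / 2) y j)) :
    Summit.AtomisticToContinuum.Crystallization.Theses.FrustratedLawDichotomy.AperiodicFrustratedLawGap :=
  aperiodicFrustratedLawGap_of_strainedPatchRec hε0 hε1 hU hDX hE
    (strainedPatchRec_of_homFloor_625_of_gammaTable_tailCert_fold k n hτ hk (homFloor_625_of_entryTrees6RBKP_HT4UQDCRX P Qf T hFcc hHcp) hT hRl hFC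
      hτs hL hsep hr7 hH hTC hdom hQ h0 hs hC hF hP hA hD) h2 h3

/-! ## §3 Sanity: the cell width of record `τ = 1/100` -/

/-- At `τ = 1/100` the numeric side conditions of R1‴ read `1/50 < s₀` and `r ≤ 349/50` (= `7 − 1/50`), exactly as for R1″. [formal bookkeeping] -/
example {𝓘 : ChartFam} {s₀ r R : ℝ} {X Xh Xe Q : SlackTab} (k : ℕ → ℝ) (n : ℕ) (hk : ∀ i : ℕ, 0 ≤ k i)
    (hHF : HomFloor (1 / 625)) (hT : TailPenalty (24 / 5) (1 / 1000)) (hRl : CoreCoreRelief (63 / 10) (63 / 10) (24 / 5) (1 / 100) (3 / 5000))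
    (hFC : FamilyCover 𝓘 (24 / 5) (1 / 100) (1 / 8) (1 / 100)) (hs₀ : 1 / 50 < s₀) (hsep : HostSep 𝓘 s₀) (hr : r ≤ 349 / 50)
    (hH : HostFarTab 𝓘 (1 / 100) r Xh) (hTC : TailCert 𝓘 (1 / 100) Xe)
    (hdom : ∀ (M₀ : ℕ) (z₀ : Fin M₀ → E3) (c₀ h : Fin M₀), Xh M₀ z₀ c₀ h + Xe M₀ z₀ c₀ h ≤ X M₀ z₀ c₀ h)
    (hQ : HostRimTop 𝓘 (1 / 100) bondD3 (cubicTail fun s => gammaMaj (s - 2 * (1 / 100))) r R Q)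
    (h0 : HostTopIn 𝓘 (1 / 100) bondD3 (cubicTail fun s => gammaMaj (s - 2 * (1 / 100))) r R (k 0 * sigmaOne))
    (hs : ∀ i : ℕ, i < n → HostStepIn 𝓘 (1 / 100) sigmaOne bondD3 (cubicTail fun s => gammaMaj (s - 2 * (1 / 100))) r hessBlk0 force0
      (foldCol R X Q) (k i) R (k (i + 1) * sigmaOne))
    (hC : SlackCert 𝓘 (1 / 100) (k n) sigmaOne hessBlk0 force0 (foldCol R X Q))
    (hF : AnnularPhaseFloor (63 / 10) (24 / 5) (63 / 10) (1 / 1000)) (hP : PolyTextureFloor (63 / 10) (24 / 5) (1 / 1000))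
    (hA : AnnularDefectFloor (24 / 5) (63 / 10)) (hD : DefectiveCollarFloor (24 / 5)) : StrainedPatchRec :=
  strainedPatchRec_of_homFloor_625_of_envelope_tailCert_fold k n (by norm_num) hk hHF hT hRl hFC (by linarith) hsep (by linarith) hH hTC hdom hQ h0
    hs hC hF hP hA hD

end Summit.AtomisticToContinuum.Crystallization.Theorems.FrustratedLawDichotomyAperiodicGapRecordJunctionFold

end
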